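import Summits.FinalStateConjecture.FinalStateConjecture.Theorems.EIHFluxBalanceInertialRecessionRechartDictionary
import Summits.FinalStateConjecture.FinalStateConjecture.Theorems.EIHFluxBalanceInertialRecessionGrowingRadius

/-!
# Route EIHFluxBalance — `InertialRecession`, re-charting: the family of re-charted `a = 0` hole
# charts (package + diagonal certified radius per hole; eventual pairwise disjointness)

Helper file for the crux `stmt-FinalStateConjecture-10166`
(`Summit.FinalStateConjecture.FinalStateConjecture.Theses.EIHFluxBalance.InertialRecession`),
stub `stub_rechart` (the transfer P2 of line `sublinear-is-free-clean-window-charges`).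

* `exists_holePackage_diag` — `hole_chart_package2'` for hole `i` repacked with the lab-time
  function at top level and a DIAGONAL certified radius `Rd → ∞` (`Rd ≥ 0`, integer-valued) along
  which the near-zone `C²` deviation of `ψ = Φ ∘ A` still tends to `0` (`exists_growing_radius'`);
* `exists_pairwise_disjoint_truncLateRegion` — for a family of such charts over pairwise receding
  centres, the truncated late images `ψᵢ({t*ᵢ > τ₁, rᵢ ≤ R})` are pairwise disjoint for `τ₁` late
  (honest zone: `ψᵢ(y) = Φ(y⁰, ξᵢ(y⁰) + L_v y̲)` with `‖L_v y̲‖ ≤ R`, injectivity of the lab chart on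
  the late region, `late_nearZones_disjoint`).

[folklore]
-/

noncomputable section

set_option linter.dupNamespace false

open scoped Topology ContDiff InnerProductSpace Manifold ENNReal BigOperators
open Filter Set Metric Topology Function TopologicalSpace Literature.Geometry.Lorentzian

namespace Summit.FinalStateConjecture.FinalStateConjecture.Theorems

/-! ### One hole: package and diagonal certified radius -/

section OneHole

variable (𝓢 : Spacetime 4) {N : ℕ} (i : Fin N) (M : Fin N → ℝ) (Λ : Fin N → ℝ → lorentzGroup)
  (ξ v : Fin N → ℝ → E3)
  (hfut : ∀ j t, 0 < (((Λ j t : E4 ≃L[ℝ] E4) (E4.basisVector 0)) 0))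
  (hvΛ : ∀ j t, E4.spatial ((Λ j t : E4 ≃L[ℝ] E4) (E4.basisVector 0)) =
    (((Λ j t : E4 ≃L[ℝ] E4) (E4.basisVector 0)) 0) • v j t)
  (U : Opens E4) (Φ : U → 𝓢.carrier) (hΦ : ContMDiff 𝓘(ℝ, E4) (𝓡 4) ∞ Φ)
  (hdev : Tendsto (fun t ↦ 𝓢.deviationCk ⟨U, fun x ↦ Minkowski.bilin +
    ∑ j, (boostedKerrBilin (Λ j (x 0)) (E4.ofTimeSpace (x 0) (ξ j (x 0))) (M j) 0 x -
      Minkowski.bilin), fun x ↦ x 0, E4.spatialNorm⟩ Φ 2 t) atTop (𝓝 0))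
  {κ₀ : ℝ} (hκ₀ : κ₀ < 1) (hvs : ∀ j t, ‖v j t‖ ≤ κ₀)
  (hv : ∀ j, ContDiff ℝ ∞ (v j)) (hξ : ∀ j, ContDiff ℝ ∞ (ξ j)) {Γ T₀ : ℝ}
  (hvb : ∀ j t, T₀ ≤ t → ∀ l, 1 ≤ l → l ≤ 2 → ‖iteratedDeriv l (v j) t‖ ≤ Γ)
  (hξb : ∀ j t, T₀ ≤ t → ∀ l, 1 ≤ l → l ≤ 2 → ‖iteratedDeriv l (ξ j) t‖ ≤ Γ)
  (hsep : ∀ j ≠ i, Tendsto (fun t ↦ ‖ξ i t - ξ j t‖) atTop atTop) (hMi : 0 < M i) {V : E3}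
  (hV : ‖V‖ < 1) (hvV : Tendsto (v i) atTop (𝓝 V)) (hξV : Tendsto (deriv (ξ i)) atTop (𝓝 V))
  (hξ0 : ∀ l, 2 ≤ l → l ≤ 3 → Tendsto (fun t ↦ iteratedDeriv l (ξ i) t) atTop (𝓝 0))
  (hv0 : ∀ l, 1 ≤ l → l ≤ 3 → Tendsto (fun t ↦ iteratedDeriv l (v i) t) atTop (𝓝 0))
  {τ₀ : ℝ} {rin : Fin N → ℝ} (hrin : ∀ j, rin j < Kerr.rPlus (M j) 0)
  (hU : {x : E4 | τ₀ < x 0 ∧ ∀ j, rin j < Kerr.radius 0 (poincareInv (Λ j (x 0))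
    (E4.ofTimeSpace (x 0) (ξ j (x 0))) x)} ⊆ (U : Set E4))

include hfut hvΛ hΦ hdev hκ₀ hvs hv hξ hvb hξb hsep hMi hvV hξV hξ0 hv0 hrin hU in
-- long statement
set_option maxHeartbeats 800000 in
/-- **Hole `i`: the `a = 0` hole-chart package with a diagonal certified radius.** The exports of
`hole_chart_package2'` used downstream (lab time `> T ≥ τ₀`, image outside every painted horizon,
honest formula, coverage, two-sided painted radius, lab-time function, fixed-radius near-zone
convergence) together with a diagonal radius `Rd → ∞`, `Rd ≥ 0`, along which the near-zone `C²`
deviation of `ψ = Φ ∘ A` still tends to `0`. [folklore] -/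
theorem exists_holePackage_diag :
    ∃ (T : ℝ) (ρ θ Rd : ℝ → ℝ) (A : E4 → E4)
      (hAU : ∀ y ∈ boostedKerrExterior (Lorentz.boost V hV) 0 (M i) 0, A y ∈ U),
      τ₀ ≤ T ∧ ContDiff ℝ ∞ A ∧ Topology.IsOpenEmbedding A ∧ Continuous ρ ∧
      Tendsto ρ atTop atTop ∧ (∀ t, 0 < ρ t) ∧ (∀ x : E4, T < A x 0) ∧
      (∀ x : E4, Kerr.rPlus (M i) 0 < ‖E4.spatial ((Lorentz.boost V hV : E4 ≃L[ℝ] E4).symm x)‖ →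
        ∀ j, Kerr.rPlus (M j) 0 <
          Kerr.radius 0 (poincareInv (Λ j (A x 0)) (E4.ofTimeSpace (A x 0) (ξ j (A x 0))) (A x))) ∧
      (∀ x : E4, T + 1 ≤ x 0 → ‖E4.spatial ((Lorentz.boost V hV : E4 ≃L[ℝ] E4).symm x)‖ ≤ ρ (x 0) / 2 →
        A x = E4.ofTimeSpace (x 0) (ξ i (x 0) +
          (E4.spatial ((Lorentz.boost V hV : E4 ≃L[ℝ] E4).symm x) -
            (Lorentz.gamma (v i (x 0)) / (Lorentz.gamma (v i (x 0)) + 1) *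
              inner ℝ (v i (x 0)) (E4.spatial ((Lorentz.boost V hV : E4 ≃L[ℝ] E4).symm x))) •
              v i (x 0)))) ∧
      (∀ x : E4, T + 1 ≤ x 0 →
        ‖E4.spatial x - ξ i (x 0) + (Lorentz.gamma (v i (x 0)) ^ 2 / (Lorentz.gamma (v i (x 0)) + 1) *
          inner ℝ (v i (x 0)) (E4.spatial x - ξ i (x 0))) • v i (x 0)‖ ≤ ρ (x 0) / 2 →
        ∃ x' : E4, A x' = x ∧ x' 0 = x 0 ∧
          E4.spatial ((Lorentz.boost V hV : E4 ≃L[ℝ] E4).symm x') = E4.spatial x - ξ i (x 0) +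
            (Lorentz.gamma (v i (x 0)) ^ 2 / (Lorentz.gamma (v i (x 0)) + 1) *
              inner ℝ (v i (x 0)) (E4.spatial x - ξ i (x 0))) • v i (x 0) ∧
          ((Lorentz.boost V hV : E4 ≃L[ℝ] E4).symm x') 0 =
            x 0 / Lorentz.gamma V - inner ℝ V (E4.spatial x - ξ i (x 0) +
              (Lorentz.gamma (v i (x 0)) ^ 2 / (Lorentz.gamma (v i (x 0)) + 1) *
                inner ℝ (v i (x 0)) (E4.spatial x - ξ i (x 0))) • v i (x 0))) ∧
      (∀ (x : E4) (Λ' : lorentzGroup), 0 < ((Λ' : E4 ≃L[ℝ] E4) (E4.basisVector 0)) 0 →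
        E4.spatial ((Λ' : E4 ≃L[ℝ] E4) (E4.basisVector 0)) =
          (((Λ' : E4 ≃L[ℝ] E4) (E4.basisVector 0)) 0) • v i (A x 0) →
        min ‖E4.spatial ((Lorentz.boost V hV : E4 ≃L[ℝ] E4).symm x)‖ (ρ (A x 0) / 2) ≤
            E4.spatialNorm ((Λ' : E4 ≃L[ℝ] E4).symm (A x - E4.ofTimeSpace (A x 0) (ξ i (A x 0)))) ∧
          E4.spatialNorm ((Λ' : E4 ≃L[ℝ] E4).symm (A x - E4.ofTimeSpace (A x 0) (ξ i (A x 0)))) ≤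
            ‖E4.spatial ((Lorentz.boost V hV : E4 ≃L[ℝ] E4).symm x)‖) ∧
      (∀ x : E4, A x 0 = θ (x 0)) ∧ (∀ s, T + 1 ≤ s → θ s = s) ∧ (∀ s, 0 < deriv θ s) ∧
      (∀ x w : E4, (fderiv ℝ A x w) 0 = deriv θ (x 0) * w 0) ∧
      (∀ Rr : ℝ, Tendsto (fun τ ↦ 𝓢.truncDeviationCk (boostedKerrBackground (Lorentz.boost V hV) 0 (M i) 0)
        (fun y ↦ Φ ⟨A y.1, hAU y.1 y.2⟩) 2 Rr τ) atTop (𝓝 0)) ∧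
      (∀ τ, 0 ≤ Rd τ) ∧ Tendsto Rd atTop atTop ∧
      Tendsto (fun τ ↦ 𝓢.truncDeviationCk (boostedKerrBackground (Lorentz.boost V hV) 0 (M i) 0)
        (fun y ↦ Φ ⟨A y.1, hAU y.1 y.2⟩) 2 (Rd τ) τ) atTop (𝓝 0) := by
  obtain ⟨T, ρ, A, hAU, hτT, hAc, hAe, hρc, hρt, hρ0, hlate, himg, hhon, hcov, hrad2,
    ⟨θ, -, -, hθ', hθid, hAθ, hDA⟩, hconv⟩ :=
    hole_chart_package2' 𝓢 i M Λ ξ v hfut hvΛ U Φ hΦ hdev hκ₀ hvs hv hξ hvb hξb hsep hMi hV hvV hξV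
      hξ0 hv0 hrin hU
  have hconvl : ∀ Rr : ℝ, Tendsto (fun τ ↦ 𝓢.truncDeviationCk
      (boostedKerrBackground (Lorentz.boost V hV) 0 (M i) 0) (fun y ↦ Φ ⟨A y.1, hAU y.1 y.2⟩) 2 Rr τ)
      atTop (𝓝 0) := fun Rr ↦ hconv _ (fun _ ↦ rfl) Rr
  obtain ⟨Rd, hRdn, hRdt, hRdc⟩ := exists_growing_radius'
    (f := fun τ r ↦ 𝓢.truncDeviationCk (boostedKerrBackground (Lorentz.boost V hV) 0 (M i) 0)
      (fun y ↦ Φ ⟨A y.1, hAU y.1 y.2⟩) 2 r τ) (fun n ↦ hconvl n)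
  refine ⟨T, ρ, θ, Rd, A, hAU, hτT, hAc, hAe, hρc.continuous, hρt, hρ0, fun x ↦ (hlate x).1, himg,
    hhon, hcov, hrad2, hAθ, hθid, hθ', hDA, hconvl, fun τ ↦ ?_, hRdt, hRdc⟩
  obtain ⟨n, hn⟩ := hRdn τ
  rw [hn]; exact n.cast_nonneg

end OneHole

/-! ### Eventual pairwise disjointness of the truncated late images -/

section Disjoint

variable {𝓢 : Spacetime 4} {N : ℕ} (M : Fin N → ℝ) (ξ v : Fin N → ℝ → E3)
  (hv1 : ∀ j t, ‖v j t‖ < 1) (V : Fin N → E3) (hV1 : ∀ i, ‖V i‖ < 1)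
  (U : Opens E4) (Φ : U → 𝓢.carrier) {τ₀ : ℝ}
  (hinj : InjOn Φ {x : U | τ₀ < x.1 0})
  (A : Fin N → E4 → E4) (T : Fin N → ℝ) (ρ : Fin N → ℝ → ℝ)
  (hAU : ∀ i, ∀ y ∈ (boostedKerrBackground (Lorentz.boost (V i) (hV1 i)) 0 (M i) 0).domain,
    A i y ∈ U)
  (hlate : ∀ i (x : E4), τ₀ < A i x 0) (hρt : ∀ i, Tendsto (ρ i) atTop atTop)
  (hhon : ∀ i (x : E4), T i + 1 ≤ x 0 →
    ‖E4.spatial ((Lorentz.boost (V i) (hV1 i) : E4 ≃L[ℝ] E4).symm x)‖ ≤ ρ i (x 0) / 2 →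
    A i x = E4.ofTimeSpace (x 0) (ξ i (x 0) +
      (E4.spatial ((Lorentz.boost (V i) (hV1 i) : E4 ≃L[ℝ] E4).symm x) -
        (Lorentz.gamma (v i (x 0)) / (Lorentz.gamma (v i (x 0)) + 1) *
          inner ℝ (v i (x 0)) (E4.spatial ((Lorentz.boost (V i) (hV1 i) : E4 ≃L[ℝ] E4).symm x))) •
          v i (x 0))))
  (hsep : ∀ i j, i ≠ j → Tendsto (fun t ↦ ‖ξ i t - ξ j t‖) atTop atTop)

include hv1 hinj hlate hρt hhon hsep in
/-- **Eventual pairwise disjointness of the truncated late images.** For every `R` there is a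
chart time `τ₁` after which the images `ψᵢ({t*ᵢ > τ₁, rᵢ ≤ R})` of the re-charted hole charts are
pairwise disjoint: such points are honest (late, small rest offset), hence mapped to lab points
`(y⁰, ξᵢ(y⁰) + L_v y̲)` within lab distance `R` of the own painted centre on the same lab slab, and
two receding centres are never both within `R` of one lab point (`late_nearZones_disjoint`).
[folklore] -/
theorem exists_pairwise_disjoint_truncLateRegion (Rr : ℝ) :
    ∃ τ₁ : ℝ, Pairwise (Function.onFun Disjoint fun i ↦
      (fun y : (boostedKerrBackground (Lorentz.boost (V i) (hV1 i)) 0 (M i) 0).domain ↦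
        Φ ⟨A i y.1, hAU i y.1 y.2⟩) ''
        (boostedKerrBackground (Lorentz.boost (V i) (hV1 i)) 0 (M i) 0).truncLateRegion τ₁ Rr) := by
  classical
  -- pairwise thresholds of `late_nearZones_disjoint`
  have hW : ∀ i j : Fin N, ∃ W : ℝ, i ≠ j → ∀ w w' : ℝ, W ≤ w → W ≤ w' → ∀ p q : E3, ‖p‖ ≤ Rr →
      ‖q‖ ≤ Rr → E4.ofTimeSpace w (ξ i w + p) ≠ E4.ofTimeSpace w' (ξ j w' + q) := by
    intro i j
    by_cases h : i = j
    · exact ⟨0, fun h' ↦ absurd h h'⟩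
    · obtain ⟨W, hW⟩ := late_nearZones_disjoint (hsep i j h) Rr
      exact ⟨W, fun _ ↦ hW⟩
  choose W hW using hW
  -- honesty thresholds
  have hρ2 : ∀ i, ∃ Tρ : ℝ, ∀ s, Tρ ≤ s → 2 * |Rr| ≤ ρ i s := fun i ↦
    eventually_atTop.1 (tendsto_atTop.1 (hρt i) (2 * |Rr|))
  choose Tρ hTρ using hρ2
  set B : ℝ := max (∑ i, (|T i| + |Tρ i| + ∑ j, |W i j|) + 1) 0 with hB
  have hBi : ∀ i j, T i + 1 ≤ B ∧ Tρ i ≤ B ∧ W i j ≤ B := by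
    intro i j
    have h1 : |T i| + |Tρ i| + ∑ j, |W i j| ≤ ∑ i, (|T i| + |Tρ i| + ∑ j, |W i j|) :=
      Finset.single_le_sum (f := fun i ↦ |T i| + |Tρ i| + ∑ j, |W i j|)
        (fun i _ ↦ by positivity) (Finset.mem_univ i)
    have h2 : |W i j| ≤ ∑ j, |W i j| :=
      Finset.single_le_sum (f := fun j ↦ |W i j|) (fun j _ ↦ abs_nonneg _) (Finset.mem_univ j)
    have h3 := le_max_left (∑ i, (|T i| + |Tρ i| + ∑ j, |W i j|) + 1) 0
    refine ⟨?_, ?_, ?_⟩ <;>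
      linarith [le_abs_self (T i), le_abs_self (Tρ i), le_abs_self (W i j), abs_nonneg (T i),
        abs_nonneg (Tρ i), abs_nonneg (W i j)]
  refine ⟨B + |Rr|, fun i j hij ↦ ?_⟩
  rw [Function.onFun, Set.disjoint_left]
  rintro p ⟨y, ⟨hy1, hy2⟩, rfl⟩ ⟨y', ⟨hy1', hy2'⟩, hyy⟩
  -- lab times of the two model points are large
  have hbig : ∀ (k : Fin N) (z : E4),
      B + |Rr| < (boostedKerrBackground (Lorentz.boost (V k) (hV1 k)) 0 (M k) 0).time z →
      (boostedKerrBackground (Lorentz.boost (V k) (hV1 k)) 0 (M k) 0).radius z ≤ Rr → B ≤ z 0 := by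
    intro k z hz1 hz2
    have h1 := apply_zero_ge_of_model (M := M k) (hV1 k) z
    have hγ1 := Lorentz.one_le_gamma (hV1 k)
    have h2 : ‖V k‖ * (boostedKerrBackground (Lorentz.boost (V k) (hV1 k)) 0 (M k) 0).radius z ≤ |Rr| := by
      have : ‖V k‖ ≤ 1 := (hV1 k).le
      have hr0 : (boostedKerrBackground (Lorentz.boost (V k) (hV1 k)) 0 (M k) 0).radius z ≤ |Rr| :=
        hz2.trans (le_abs_self _)
      by_cases hr : 0 ≤ (boostedKerrBackground (Lorentz.boost (V k) (hV1 k)) 0 (M k) 0).radius z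
      · nlinarith
      · nlinarith [norm_nonneg (V k), abs_nonneg Rr]
    have h3 : B ≤ (boostedKerrBackground (Lorentz.boost (V k) (hV1 k)) 0 (M k) 0).time z -
        ‖V k‖ * (boostedKerrBackground (Lorentz.boost (V k) (hV1 k)) 0 (M k) 0).radius z := by
      linarith
    have hB0 : 0 ≤ B := le_max_right _ _
    nlinarith
  have hy0 := hbig i y.1 hy1 hy2
  have hy0' := hbig j y'.1 hy1' hy2'
  -- honest forms
  have hrad : ∀ (k : Fin N) (z : E4), (boostedKerrBackground (Lorentz.boost (V k) (hV1 k)) 0 (M k) 0).radius z =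
      ‖E4.spatial ((Lorentz.boost (V k) (hV1 k) : E4 ≃L[ℝ] E4).symm z)‖ := by
    intro k z
    show Kerr.radius 0 (poincareInv _ 0 z) = _
    rw [poincareInv_zero, Kerr.radius_zero_left, E4.spatialNorm]
  have hRr : Rr ≤ |Rr| := le_abs_self Rr
  have hhy : A i y.1 = _ := hhon i y.1 (by linarith [(hBi i j).1]) (by
    rw [← hrad]; have := hTρ i (y.1 0) ((hBi i j).2.1.trans hy0); linarith)
  have hhy' : A j y'.1 = _ := hhon j y'.1 (by linarith [(hBi j i).1]) (by
    rw [← hrad]; have := hTρ j (y'.1 0) ((hBi j i).2.1.trans hy0'); linarith)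
  -- the lab points coincide
  have hAA : A i y.1 = A j y'.1 := by
    have h := hinj (hlate i y.1) (hlate j y'.1) hyy.symm
    exact congrArg Subtype.val h
  rw [hhy, hhy'] at hAA
  refine hW i j hij (y.1 0) (y'.1 0) ((hBi i j).2.2.trans hy0) ((hBi i j).2.2.trans hy0') _ _ ?_ ?_ hAA
  · refine (norm_restOffset_le (hv1 i _) _).trans ?_
    rw [← hrad]; exact hy2
  · refine (norm_restOffset_le (hv1 j _) _).trans ?_
    rw [← hrad]; exact hy2'

/-- Registered one-line form (stub `pairwise_disjoint_truncLateRegion_rechart` of the crux item) of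
`exists_pairwise_disjoint_truncLateRegion`. [folklore] -/
theorem pairwise_disjoint_truncLateRegion_rechart : open Literature.Geometry.Lorentzian Filter Topology in ∀ {𝓢 : Spacetime 4} {N : ℕ} (M : Fin N → ℝ) (ξ v : Fin N → ℝ → E3), (∀ j t, ‖v j t‖ < 1) → ∀ (V : Fin N → E3) (hV1 : ∀ i, ‖V i‖ < 1) (U : TopologicalSpace.Opens E4) (Φ : U → 𝓢.carrier) {τ₀ : ℝ}, Set.InjOn Φ {x : U | τ₀ < x.1 0} → ∀ (A : Fin N → E4 → E4) (T : Fin N → ℝ) (ρ : Fin N → ℝ → ℝ) (hAU : ∀ i, ∀ y ∈ (boostedKerrBackground (Lorentz.boost (V i) (hV1 i)) 0 (M i) 0).domain, A i y ∈ U), (∀ i (x : E4), τ₀ < A i x 0) → (∀ i, Tendsto (ρ i) atTop atTop) → (∀ i (x : E4), T i + 1 ≤ x 0 → ‖E4.spatial ((Lorentz.boost (V i) (hV1 i) : E4 ≃L[ℝ] E4).symm x)‖ ≤ ρ i (x 0) / 2 → A i x = E4.ofTimeSpace (x 0) (ξ i (x 0) + (E4.spatial ((Lorentz.boost (V i) (hV1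 i) : E4 ≃L[ℝ] E4).symm x) - (Lorentz.gamma (v i (x 0)) / (Lorentz.gamma (v i (x 0)) + 1) * inner ℝ (v i (x 0)) (E4.spatial ((Lorentz.boost (V i) (hV1 i) : E4 ≃L[ℝ] E4).symm x))) • v i (x 0)))) → (∀ i j, i ≠ j → Tendsto (fun t ↦ ‖ξ i t - ξ j t‖) atTop atTop) → ∀ Rr : ℝ, ∃ τ₁ : ℝ, Pairwise (Function.onFun Disjoint fun i ↦ (fun y : (boostedKerrBackground (Lorentz.boost (V i) (hV1 i)) 0 (M i) 0).domain ↦ Φ ⟨A i y.1, hAU i y.1 y.2⟩) '' (boostedKerrBackground (Lorentz.boost (V i) (hV1 i)) 0 (M i) 0).truncLateRegion τ₁ Rr) :=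
  fun M ξ v hv1 V hV1 U Φ _ hinj A T ρ hAU hlate hρt hhon hsep Rr ↦
    exists_pairwise_disjoint_truncLateRegion M ξ v hv1 V hV1 U Φ hinj A T ρ hAU hlate hρt hhon hsep Rr

end Disjoint

end Summit.FinalStateConjecture.FinalStateConjecture.Theorems

end
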